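import Literature.Geometry.Lorentzian.KerrRegionIISpeedBound
import Literature.Geometry.Lorentzian.KerrRegionIIClock
import Literature.Geometry.Lorentzian.LorentzianDistance
import Literature.Geometry.Lorentzian.OpensCausality
import Mathlib.MeasureTheory.Integral.IntervalIntegral.FundThmCalculus
import HarnessLib

/-!
# Region II of a sub-extremal Kerr black hole has finite timelike diameter

(family `gr`; namespace `Literature.Geometry.Lorentzian.Kerr`)

In the ingoing Kerr–Schild spacetime `Kerr.spacetime M a r₋ hM = ({r > r₋}, g_{M,a}, V)` of a
sub-extremal Kerr black hole (`|a| < M`), every future causal curve segment issuing from a point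
`x` with `r(x) < r₊` — a point of the black-hole region II, `r₋ < r < r₊` — has proper-time
length at most the universal constant `C(M, a) = √(r₊² + a²) · 4√2`; hence the time separation
satisfies `d(x, y) ≤ C(M, a)` for every `y` (`Kerr.lorentzDist_le_of_radius_lt_rPlus`). This is the
finite timelike diameter of region II ("the time remaining before the Cauchy horizon is bounded"),
the quantitative content of O'Neill 1995, §2.5 (`r` is a time function on II; Boyer–Lindquist
`g^{rr} = Δ/Σ`), and the named fact F_B3 of the exact-Kerr bookkeeping of crux
`TameCensorship` (item stmt-FinalStateConjecture-10047) of `FinalStateConjecture`.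

Proof. Along a future causal curve `γ` of the chart the radius `f = r ∘ γ` is differentiable with
`f' = dr(γ') = g(W, γ')`, `W = g⁻¹dr` (`KerrRadiusGradientVector`); while `r₋ < f < r₊`,
`f' < 0` and the speed obeys `√(−g(γ', γ')) ≤ −f' · √((r₊² + a²)/((r₊ − f)(f − r₋)))`
(`KerrRegionIISpeedBound`). A continuity (least upper bound) argument shows `f` never returns
to `r₊`, so `f` is non-increasing on the whole parameter interval and the speed is dominated by
the derivative of the bounded clock `−√(r₊² + a²) · K(f)` (`KerrRegionIIClock`); the fundamental
theorem of calculus for this monotone function (Mathlib's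
`intervalIntegral.integrableOn_deriv_of_nonneg`, `integral_eq_sub_of_hasDerivAt_of_le`)
bounds the length (`Kerr.arcLength_le_of_radius_lt_rPlus`), and the time separation is the
supremum of these lengths (O'Neill 1983, Def. 14.15).

## References

* B. O'Neill, *The Geometry of Kerr Black Holes*, A K Peters 1995, §2.4–2.5. Key `ONeill1995`.
* B. O'Neill, *Semi-Riemannian geometry*, Academic Press 1983, Ch. 5, Prop. 5.30; Ch. 14,
  Def. 14.15. Key `ONeillSemiRiemannian1983`.
* M. Dafermos, J. Luk, *The interior of dynamical vacuum black holes I*, arXiv:1710.01722, §1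
  (the Kerr Cauchy horizon as the future boundary of the maximal development). Key `DafermosLuk2017`.
-/

noncomputable section

open Set Filter MeasureTheory
open scoped Manifold Topology ENNReal

namespace Literature.Geometry.Lorentzian.Kerr

variable [Facts] {M a r₀ : ℝ} {hM : 0 ≤ M}

/-! ### Future causal curves of the Kerr–Schild chart, in coordinates -/

/-- Along a future causal curve of the Kerr–Schild spacetime `Kerr.spacetime M a r₀ hM` the
coordinate curve is differentiable with velocity `v = (γ)'`, `g(v, v) ≤ 0`, `v ≠ 0` and
`g(V, v) < 0` (`d(Subtype.val) = id`; the bundled metric and orientation are `Kerr.bilin`,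
`Kerr.timeVector`). [folklore] -/
theorem causalCurve_velocity {γ : ℝ → region a r₀} {s : Set ℝ}
    (hγ : (spacetime M a r₀ hM).metric.IsFutureCausalCurveOn (spacetime M a r₀ hM).timeOrientation γ s)
    {t : ℝ} (ht : t ∈ s) :
    HasDerivAt (fun σ ↦ (γ σ : E4)) (deriv (fun σ ↦ (γ σ : E4)) t) t ∧
      bilin M a (γ t) (deriv (fun σ ↦ (γ σ : E4)) t) (deriv (fun σ ↦ (γ σ : E4)) t) ≤ 0 ∧
      deriv (fun σ ↦ (γ σ : E4)) t ≠ 0 ∧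
      bilin M a (γ t) (timeVector M a (γ t)) (deriv (fun σ ↦ (γ σ : E4)) t) < 0 := by
  obtain ⟨hd, ⟨hcaus, hne⟩, hfd⟩ := hγ t ht
  have hd' : DifferentiableAt ℝ (fun σ ↦ (γ σ : E4)) t :=
    mdifferentiableAt_iff_differentiableAt.mp
      ((mdifferentiableAt_subtypeVal_comp_curve_iff (I := 𝓘(ℝ, E4)) (region a r₀)).2 hd)
  have hv : (velocity 𝓘(ℝ, E4) γ t : E4) = deriv (fun σ ↦ (γ σ : E4)) t := by
    rw [← velocity_subtypeVal_comp (I := 𝓘(ℝ, E4)) (region a r₀) γ t]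
    unfold velocity
    rw [mfderiv_eq_fderiv]
    rfl
  refine ⟨hd'.hasDerivAt, ?_, ?_, ?_⟩
  · have h1 : bilin M a (γ t) (velocity 𝓘(ℝ, E4) γ t) (velocity 𝓘(ℝ, E4) γ t) ≤ 0 := hcaus
    rwa [hv] at h1
  · intro h0
    apply hne
    have : (velocity 𝓘(ℝ, E4) γ t : E4) = 0 := hv.trans h0
    exact this
  · have h2 : bilin M a (γ t) (timeVector M a (γ t)) (velocity 𝓘(ℝ, E4) γ t) < 0 := hfd
    rwa [hv] at h2

/-- `d/dσ r(γ σ) = dr(v⃗)` along a future causal curve of the chart (chain rule with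
`Kerr.hasFDerivAt_radius`). [folklore] -/
theorem hasDerivAt_radius_causalCurve {γ : ℝ → region a r₀} {s : Set ℝ}
    (hγ : (spacetime M a r₀ hM).metric.IsFutureCausalCurveOn (spacetime M a r₀ hM).timeOrientation γ s)
    {t : ℝ} (ht : t ∈ s) :
    HasDerivAt (fun σ ↦ radius a (γ σ))
      (radiusGrad a (E4.spatial (γ t : E4)) (E4.spatial (deriv (fun σ ↦ (γ σ : E4)) t))) t := by
  have h1 := (causalCurve_velocity hγ ht).1
  have hx : 0 < radius a (γ t) := radius_pos_of_mem_region (γ t).2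
  have := (hasFDerivAt_radius hx).comp_hasDerivAt t h1
  simpa [Function.comp_def] using this

/-- The speed of a curve of the Kerr–Schild spacetime is `√(−g(v, v))` for the coordinate velocity
`v` (a causal curve has `g(v, v) ≤ 0`). O'Neill 1983, Ch. 5, Def. 5.11. [cite: ONeillSemiRiemannian1983, Ch. 5, Def. 5.11 (pp. 131–132)] -/
theorem speed_causalCurve {γ : ℝ → region a r₀} {s : Set ℝ}
    (hγ : (spacetime M a r₀ hM).metric.IsFutureCausalCurveOn (spacetime M a r₀ hM).timeOrientation γ s)
    {t : ℝ} (ht : t ∈ s) :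
    (spacetime M a r₀ hM).metric.toPseudoRiemannianMetric.speed γ t =
      Real.sqrt (-(bilin M a (γ t) (deriv (fun σ ↦ (γ σ : E4)) t) (deriv (fun σ ↦ (γ σ : E4)) t))) := by
  obtain ⟨-, hle, -, -⟩ := causalCurve_velocity hγ ht
  have hv : (velocity 𝓘(ℝ, E4) γ t : E4) = deriv (fun σ ↦ (γ σ : E4)) t := by
    rw [← velocity_subtypeVal_comp (I := 𝓘(ℝ, E4)) (region a r₀) γ t]
    unfold velocity
    rw [mfderiv_eq_fderiv]
    rfl
  rw [PseudoRiemannianMetric.speed_def]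
  show Real.sqrt |bilin M a (γ t) (velocity 𝓘(ℝ, E4) γ t) (velocity 𝓘(ℝ, E4) γ t)| = _
  rw [hv, abs_of_nonpos hle]

/-! ### `r` never returns to `r₊` and is non-increasing -/

/-- **Along a future causal curve of `Kerr.spacetime M a r₋ hM` starting with `r < r₊`, the
radius stays below `r₊` and is non-increasing** (sub-extremal Kerr). While `r₋ < r < r₊` the
derivative `dr(v) < 0` (`Kerr.radiusGrad_lt_zero_of_isFutureDirected`); if `r` reached `r₊` at a
first parameter `t⋆ > t₀`, it would be non-increasing on `[t₀, t⋆]` (mean value theorem), so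
`r(t⋆) ≤ r(t₀) < r₊` — a contradiction. O'Neill 1995, §2.5 (no future causal curve leaves
region II into region I). [cite: ONeill1995, §2.5] -/
theorem radius_causalCurve_le (h : |a| < M) {γ : ℝ → region a (rMinus M a)}
    {t₀ t₁ : ℝ}
    (hγ : (spacetime M a (rMinus M a) hM).metric.IsFutureCausalCurveOn
      (spacetime M a (rMinus M a) hM).timeOrientation γ (Icc t₀ t₁))
    (h₀ : radius a (γ t₀) < rPlus M a) {t : ℝ} (ht : t ∈ Icc t₀ t₁) :
    radius a (γ t) ≤ radius a (γ t₀) := by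
  set f : ℝ → ℝ := fun σ ↦ radius a (γ σ) with hf
  have hder : ∀ σ ∈ Icc t₀ t₁, HasDerivAt f
      (radiusGrad a (E4.spatial (γ σ : E4)) (E4.spatial (deriv (fun σ ↦ (γ σ : E4)) σ))) σ :=
    fun σ hσ ↦ hasDerivAt_radius_causalCurve hγ hσ
  have hcont : ContinuousOn f (Icc t₀ t₁) := fun σ hσ ↦ (hder σ hσ).continuousAt.continuousWithinAt
  have hmin : ∀ σ ∈ Icc t₀ t₁, rMinus M a < f σ := fun σ _ ↦ by
    exact lt_radius_of_mem_region (γ σ).2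
  -- derivative negative wherever `f < r₊`
  have hneg : ∀ σ ∈ Icc t₀ t₁, f σ < rPlus M a → deriv f σ < 0 := by
    intro σ hσ hlt
    rw [(hder σ hσ).deriv]
    obtain ⟨-, hle, hne, hfd⟩ := causalCurve_velocity hγ hσ
    exact radiusGrad_lt_zero_of_isFutureDirected h (hmin σ hσ) hlt hle hne hfd
  -- antitone on any `[t₀, b] ⊆ [t₀, t₁]` on which `f < r₊` away from `b`
  have hanti : ∀ b ∈ Icc t₀ t₁, (∀ σ ∈ Ico t₀ b, f σ < rPlus M a) → AntitoneOn f (Icc t₀ b) := by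
    intro b hb hlt
    have hsub : Icc t₀ b ⊆ Icc t₀ t₁ := Icc_subset_Icc le_rfl hb.2
    refine antitoneOn_of_deriv_nonpos (convex_Icc t₀ b) (hcont.mono hsub) ?_ ?_
    · rw [interior_Icc]
      exact fun σ hσ ↦ ((hder σ (hsub (Ioo_subset_Icc_self hσ))).differentiableAt).differentiableWithinAt
    · rw [interior_Icc]
      exact fun σ hσ ↦ (hneg σ (hsub (Ioo_subset_Icc_self hσ)) (hlt σ ⟨hσ.1.le, hσ.2⟩)).le
  -- `f < r₊` on the whole interval
  have hlt : ∀ σ ∈ Icc t₀ t₁, f σ < rPlus M a := by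
    by_contra hcon
    push Not at hcon
    obtain ⟨σ₁, hσ₁, hge⟩ := hcon
    set B : Set ℝ := Icc t₀ t₁ ∩ f ⁻¹' Ici (rPlus M a) with hB
    have hBcl : IsClosed B := hcont.preimage_isClosed_of_isClosed isClosed_Icc isClosed_Ici
    have hBne : B.Nonempty := ⟨σ₁, hσ₁, hge⟩
    have hBbdd : BddBelow B := ⟨t₀, fun σ hσ ↦ hσ.1.1⟩
    set b := sInf B with hb
    have hbB : b ∈ B := hBcl.csInf_mem hBne hBbdd
    have hbI : b ∈ Icc t₀ t₁ := hbB.1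
    have hfb : rPlus M a ≤ f b := hbB.2
    have hbelow : ∀ σ ∈ Ico t₀ b, f σ < rPlus M a := by
      intro σ hσ
      by_contra hσ'
      push Not at hσ'
      have hσB : σ ∈ B := ⟨⟨hσ.1, hσ.2.le.trans hbI.2⟩, hσ'⟩
      exact (lt_irrefl σ) (hσ.2.trans_le (csInf_le hBbdd hσB))
    have hmono := hanti b hbI hbelow
    have : f b ≤ f t₀ := hmono (left_mem_Icc.2 hbI.1) (right_mem_Icc.2 hbI.1) hbI.1
    exact (lt_irrefl (rPlus M a)) (hfb.trans_lt (this.trans_lt h₀))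
  have hmono := hanti t₁ ⟨ht.1.trans ht.2, le_rfl⟩ fun σ hσ ↦ hlt σ ⟨hσ.1, hσ.2.le⟩
  exact hmono (left_mem_Icc.2 (ht.1.trans ht.2)) ht ht.1

/-! ### The length bound -/

/-- **Future causal segments of region II have uniformly bounded length**: in
`Kerr.spacetime M a r₋ hM` (sub-extremal), a future causal curve segment `γ|[t₀, t₁]` with
`r(γ t₀) < r₊` has `L(γ|[t₀, t₁]) ≤ √(r₊² + a²) · regionIIClockBound r₋ r₊` (`= 4√2 √(r₊² + a²)`).
The speed is dominated by the derivative of the bounded monotone clock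
`−√(r₊² + a²) K(r ∘ γ)` (`Kerr.sqrt_neg_bilin_le_clockRate_mul`,
`Kerr.inv_sqrt_mul_le_regionIIClockDeriv`), which is integrated by the fundamental theorem of
calculus. O'Neill 1995, §2.5. [cite: ONeill1995, §2.5; ONeillSemiRiemannian1983, Ch. 5, Def. 5.11 (pp. 131–132)] -/
theorem arcLength_le_of_radius_lt_rPlus (h : |a| < M)
    {γ : ℝ → region a (rMinus M a)} {t₀ t₁ : ℝ} (ht : t₀ < t₁)
    (hγ : (spacetime M a (rMinus M a) hM).metric.IsFutureCausalCurveOn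
      (spacetime M a (rMinus M a) hM).timeOrientation γ (Icc t₀ t₁))
    (h₀ : radius a (γ t₀) < rPlus M a) :
    (spacetime M a (rMinus M a) hM).metric.toPseudoRiemannianMetric.arcLength γ t₀ t₁ ≤
      ENNReal.ofReal (Real.sqrt (rPlus M a ^ 2 + a ^ 2) * regionIIClockBound (rMinus M a) (rPlus M a)) := by
  set X := Real.sqrt (rPlus M a ^ 2 + a ^ 2) with hX_def
  set f : ℝ → ℝ := fun σ ↦ radius a (γ σ) with hf
  set u : ℝ → E4 := fun σ ↦ deriv (fun σ ↦ (γ σ : E4)) σ with hu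
  have hX0 : 0 ≤ X := Real.sqrt_nonneg _
  -- `m < f < p` along the segment
  have hfm : ∀ σ ∈ Icc t₀ t₁, rMinus M a < f σ := fun σ _ ↦ by
    exact lt_radius_of_mem_region (γ σ).2
  have hfp : ∀ σ ∈ Icc t₀ t₁, f σ < rPlus M a := fun σ hσ ↦
    (radius_causalCurve_le h hγ h₀ hσ).trans_lt h₀
  -- `f' = dr(u)` and the clock `H = −X K(f)`
  have hder : ∀ σ ∈ Icc t₀ t₁, HasDerivAt f
      (radiusGrad a (E4.spatial (γ σ : E4)) (E4.spatial (u σ))) σ :=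
    fun σ hσ ↦ hasDerivAt_radius_causalCurve hγ hσ
  set H : ℝ → ℝ := fun σ ↦ -X * regionIIClock (rMinus M a) (rPlus M a) (f σ) with hH
  set H' : ℝ → ℝ := fun σ ↦ -X * (regionIIClockDeriv (rMinus M a) (rPlus M a) (f σ) *
    radiusGrad a (E4.spatial (γ σ : E4)) (E4.spatial (u σ))) with hH'
  have hHder : ∀ σ ∈ Icc t₀ t₁, HasDerivAt H (H' σ) σ := fun σ hσ ↦
    HasDerivAt.const_mul (-X)
      ((hasDerivAt_regionIIClock (hfm σ hσ) (hfp σ hσ)).comp σ (hder σ hσ))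
  have hHcont : ContinuousOn H (Icc t₀ t₁) := fun σ hσ ↦ (hHder σ hσ).continuousAt.continuousWithinAt
  -- the pointwise speed bound `speed ≤ H'` and `0 ≤ H'`
  have hdata : ∀ σ ∈ Icc t₀ t₁,
      (spacetime M a (rMinus M a) hM).metric.toPseudoRiemannianMetric.speed γ σ ≤ H' σ ∧ 0 ≤ H' σ := by
    intro σ hσ
    obtain ⟨-, hle, hne, hfd⟩ := causalCurve_velocity hγ hσ
    have hd : radiusGrad a (E4.spatial (γ σ : E4)) (E4.spatial (u σ)) < 0 :=
      radiusGrad_lt_zero_of_isFutureDirected h (hfm σ hσ) (hfp σ hσ) hle hne hfd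
    have hK := regionIIClockDeriv_pos (hfm σ hσ) (hfp σ hσ)
    have hnn : 0 ≤ H' σ := by
      simp only [hH']
      nlinarith [mul_pos hK (neg_pos.2 hd)]
    refine ⟨?_, hnn⟩
    rw [speed_causalCurve hγ hσ]
    have h1 := sqrt_neg_bilin_le_clockRate_mul h (hfm σ hσ) (hfp σ hσ) hle hne hfd
    refine h1.trans ?_
    -- `√((p² + a²)/((p − f)(f − m))) ≤ X · K'(f)`
    have hAB : 0 < (rPlus M a - f σ) * (f σ - rMinus M a) := mul_pos (by linarith [hfp σ hσ]) (by linarith [hfm σ hσ])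
    have hrate : Real.sqrt ((rPlus M a ^ 2 + a ^ 2) / ((rPlus M a - f σ) * (f σ - rMinus M a))) ≤
        X * regionIIClockDeriv (rMinus M a) (rPlus M a) (f σ) := by
      rw [Real.sqrt_div' _ hAB.le, div_eq_mul_one_div]
      exact mul_le_mul_of_nonneg_left (inv_sqrt_mul_le_regionIIClockDeriv (hfm σ hσ) (hfp σ hσ)) hX0
    have h2 := mul_le_mul_of_nonneg_left hrate (neg_nonneg.2 hd.le)
    refine h2.trans_eq ?_
    simp only [hH']
    ring
  -- fundamental theorem of calculus for the monotone clock `H`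
  have hint : IntegrableOn H' (Ioc t₀ t₁) :=
    intervalIntegral.integrableOn_deriv_of_nonneg hHcont
      (fun σ hσ ↦ hHder σ (Ioo_subset_Icc_self hσ)) (fun σ hσ ↦ (hdata σ (Ioo_subset_Icc_self hσ)).2)
  have hFTC : ∫ σ in Ioc t₀ t₁, H' σ = H t₁ - H t₀ := by
    rw [← intervalIntegral.integral_of_le ht.le]
    exact intervalIntegral.integral_eq_sub_of_hasDerivAt_of_le ht.le hHcont
      (fun σ hσ ↦ hHder σ (Ioo_subset_Icc_self hσ))
      ((intervalIntegrable_iff_integrableOn_Ioc_of_le ht.le).2 hint)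
  -- the oscillation of the clock
  have hosc : H t₁ - H t₀ ≤ X * regionIIClockBound (rMinus M a) (rPlus M a) := by
    have ht₀ : t₀ ∈ Icc t₀ t₁ := left_mem_Icc.2 ht.le
    have ht₁ : t₁ ∈ Icc t₀ t₁ := right_mem_Icc.2 ht.le
    have hK := regionIIClock_sub_le (hfm t₀ ht₀).le (hfp t₀ ht₀).le (hfm t₁ ht₁).le (hfp t₁ ht₁).le
    have : H t₁ - H t₀ = X * (regionIIClock (rMinus M a) (rPlus M a) (f t₀) - regionIIClock (rMinus M a) (rPlus M a) (f t₁)) := by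
      simp only [hH]
      ring
    rw [this]
    exact mul_le_mul_of_nonneg_left hK hX0
  -- integrate
  have hmono : (spacetime M a (rMinus M a) hM).metric.toPseudoRiemannianMetric.arcLength γ t₀ t₁ ≤
      ∫⁻ σ in Icc t₀ t₁, ENNReal.ofReal (H' σ) := by
    rw [PseudoRiemannianMetric.arcLength_eq_lintegral_Icc]
    exact setLIntegral_mono' measurableSet_Icc fun σ hσ ↦ ENNReal.ofReal_le_ofReal (hdata σ hσ).1
  have hnn : 0 ≤ᵐ[volume.restrict (Ioc t₀ t₁)] H' :=
    ae_restrict_of_forall_mem measurableSet_Ioc fun σ hσ ↦ (hdata σ ⟨hσ.1.le, hσ.2⟩).2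
  have heq : ∫⁻ σ in Icc t₀ t₁, ENNReal.ofReal (H' σ) = ENNReal.ofReal (H t₁ - H t₀) := by
    rw [← restrict_Ioc_eq_restrict_Icc, ← ofReal_integral_eq_lintegral_ofReal hint hnn, hFTC]
  calc (spacetime M a (rMinus M a) hM).metric.toPseudoRiemannianMetric.arcLength γ t₀ t₁
      ≤ ∫⁻ σ in Icc t₀ t₁, ENNReal.ofReal (H' σ) := hmono
    _ = ENNReal.ofReal (H t₁ - H t₀) := heq
    _ ≤ ENNReal.ofReal (X * regionIIClockBound (rMinus M a) (rPlus M a)) := ENNReal.ofReal_le_ofReal hosc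

/-- **Region II of a sub-extremal Kerr black hole has finite timelike diameter**: in the
ingoing Kerr–Schild spacetime `Kerr.spacetime M a r₋ hM`, `|a| < M`, the time separation from
any point `x` with `r(x) < r₊` satisfies `d(x, y) ≤ √(r₊² + a²) · regionIIClockBound r₋ r₊`
(`= 4√2 · √(r₊² + a²)`) for every `y`. (The competing segments of O'Neill's Def. 14.15 are the
segments of `arcLength_le_of_radius_lt_rPlus`.) O'Neill 1995, §2.5; O'Neill 1983, Ch. 14,
Def. 14.15. [cite: ONeill1995, §2.5; ONeillSemiRiemannian1983, Ch. 14, Def. 14.15 (p. 409)] -/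
theorem lorentzDist_le_of_radius_lt_rPlus (h : |a| < M) (hM : 0 ≤ M)
    (x y : (spacetime M a (rMinus M a) hM).carrier) (hx : radius a x.1 < rPlus M a) :
    (spacetime M a (rMinus M a) hM).lorentzDist x y ≤
      ENNReal.ofReal (Real.sqrt (rPlus M a ^ 2 + a ^ 2) * regionIIClockBound (rMinus M a) (rPlus M a)) := by
  refine LorentzianMetric.lorentzDist_le_iff.2 fun γ t₀ t₁ ht hγ hγ₀ _ ↦ ?_
  have h₀ : radius a (γ t₀).1 < rPlus M a := by rw [hγ₀]; exact hx
  exact arcLength_le_of_radius_lt_rPlus h ht hγ h₀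

end Literature.Geometry.Lorentzian.Kerr

end
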